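import Literature.Barriers.AnomalousDissipation.ShearFlowViscositySelectionLimitEq
import Literature.Analysis.FunctionSpaces.TorusAxisAverageWeakLimit
import HarnessLib

/-!
# Bardos–Titi–Wiedemann 2012, Thm. 5 — the limit-equation fact
`BardosTitiWiedemann2012_thm5_limitEq` from Lemma 4 (modular route)

Theorem-only companion to `ShearFlowViscositySelectionLimitSteps.lean` (the named fact
`BardosTitiWiedemann2012_thm5_limitEq`: the weak-* limit of the third components of the
two-and-a-half-dimensional Leray–Hopf solutions is the third component of the shear flow,
`W(t,x) = v₃(x₁ - t v₁(x₂), x₂)`; Bardos–Titi–Wiedemann, C. R. Math. 350 (2012), proof of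
Thm. 5: "`u` satisfies (6) … Indeed, the equation for `u₃` follows from `u₁^ν u₃^ν ⇀* u₁u₃`,
thanks to the strong convergence of `u₁^ν` to `u₁`. Next, it follows from Lemma 4 above that
system (6) has a unique solution, and that this unique solution is given precisely by the shear
flow (4)"). This file assembles the implication
`BardosTitiWiedemann2012_lemma4 → BardosTitiWiedemann2012_thm5_limitEq`
(`BardosTitiWiedemann2012_thm5_limitEq_of_lemma4`) from four proved inputs, sentence by
sentence — the modular route through the shared `axisAvg`/`planarSect` API; the unconditional
discharge `BardosTitiWiedemann2012_thm5_limitEq_holds` lives in the sibling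
`ShearFlowViscositySelectionLimitEqDischarge.lean` (a self-contained derivation landed in
parallel), and also follows from the theorem here and `BardosTitiWiedemann2012_lemma4_holds`:

1. `BardosTitiWiedemann2012_thm5_limit_weakTransport` (`ShearFlowViscositySelectionLimitEq`):
   the weak `L²_{t,x}`-limit `W` solves the transport equation (6) weakly on `T³`, against all
   tests `ψ(t, x₁, x₂)`;
2. `Torus.ae_eq_axisAvg_of_tendsto` (`TorusAxisAverageWeakLimit`): `W` does not depend on `x₃` —
   it is a.e. its third-axis average `axisAvg (Fin.last 2) (W t)`, the planar lift of the
   descended field `w t = axisAvg (Fin.last 2) (W t) ∘ planarSect` (`TorusAxisAverageCalculus`);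
3. `isWeakScalarTransportOn_axisAvg_limit` (here): `w` is a weak solution, in
   `L^∞(0,T;L²(T²))`, of the Cauchy problem of Lemma 4 (accepted
   `Torus.IsWeakScalarTransportOn T 0 (shearVelocity v₁) v₃`), as is the shear transport
   (`isWeakScalarTransportOn_shearTransport`, `ShearFlowViscositySelectionTransport`);
4. the uniqueness conjunct of `BardosTitiWiedemann2012_lemma4` (discharged in
   `ShearFlowViscositySelectionLemma4`): `w` is the shear transport and `W` its planar lift
   (`BardosTitiWiedemann2012_thm5_limitEq_of_lemma4`).

## References

* C. Bardos, E. S. Titi, E. Wiedemann, C. R. Math. Acad. Sci. Paris 350 (2012) 757–760, Lemma 4,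
  Thm. 5 and its proof, system (6) (`BardosTitiWiedemann2012`).
* C. Bardos, E. S. Titi, Discrete Contin. Dyn. Syst. Ser. S 3 (2010), Thm. 2 (`BardosTiti2010`).
-/

noncomputable section
namespace Literature.Barriers.AnomalousDissipation

open MeasureTheory Set Filter Function
open _root_.Topology
open scoped ENNReal NNReal InnerProductSpace RealInnerProductSpace
open Literature.Analysis.FunctionSpaces.Torus (axisAvg planarSect planarProj)

/-! ## The descended limit solves the transport equation of Lemma 4 on `T²` -/

section Reduction

variable {T : ℝ} {v₁ : UnitAddCircle → ℝ} {v₃ : UnitAddTorus (Fin 2) → ℝ}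
  {W : ℝ → UnitAddTorus (Fin 3) → ℝ}

/-- **The descended weak-* limit is a weak solution of the transport equation of Lemma 4 on
`T²`** (Bardos–Titi–Wiedemann 2012, proof of Thm. 5, system (6), third and fourth lines, as a
statement about the accepted `Torus.IsWeakScalarTransportOn T 0 (shearVelocity v₁) v₃`): if
`W ∈ L^∞(0,T;L²(T³))` (measurable lift) satisfies the weak transport identity on `T³` against
all tests `ψ(t,x₁,x₂)` (`BardosTitiWiedemann2012_thm5_limit_weakTransport`), then the planar
section of its third-axis average, `w(t,x₁,x₂) = ∫ W(t,x₁,x₂,s) ds` (the tree's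
`axisAvg (Fin.last 2) (W t) ∘ planarSect`), is a weak solution in `L^∞(0,T;L²(T²))` with datum
`v₃`: the adjunction `∫_{T³} W · (h ∘ planarProj) = ∫_{T²} w · h`
(`Torus.setIntegral_integral_mul_comp_planarProj_eq`) converts the identity, the `L^∞_t L²_x`
bound passes to the average (`eLpNorm_axisAvg_comp_planarSect_le`), and the velocity clauses are
those of the shear velocity (`isWeakScalarTransportOn_shearTransport`). [cite: BardosTitiWiedemann2012, Thm. 5, proof] -/
theorem isWeakScalarTransportOn_axisAvg_limit (hv₁ : MemLp v₁ 2 volume) (hv₃ : MemLp v₃ 2 volume)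
    (hT : 0 < T)
    (hWm : AEStronglyMeasurable (Literature.Analysis.FunctionSpaces.Torus.stLift W)
      (volume.restrict (Ioo 0 T ×ˢ univ)))
    (hWb : ∃ C : ℝ≥0, ∀ᵐ t ∂(volume.restrict (Ioo 0 T)), ∫⁻ x, ‖W t x‖ₑ ^ 2 ≤ C)
    (hWeq : ∀ ψ : ℝ → UnitAddTorus (Fin 2) → ℝ, Literature.Analysis.FunctionSpaces.Torus.IsSpaceTimeTest T ψ →
      (∫ t in Ioo 0 T, ∫ x : UnitAddTorus (Fin 3), W t x *
        (Literature.Analysis.FunctionSpaces.Torus.timeDeriv ψ t (Fin.init x) +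
          v₁ (x 1) * Literature.Analysis.FunctionSpaces.Torus.partialDeriv 0 (ψ t) (Fin.init x))) +
      ∫ x : UnitAddTorus (Fin 3), v₃ (Fin.init x) * ψ 0 (Fin.init x) = 0) :
    Literature.Analysis.FluidPDE.Torus.IsWeakScalarTransportOn T 0 (shearVelocity v₁) v₃
      (fun t => axisAvg (Fin.last 2) (W t) ∘ planarSect) := by
  have hS := isWeakScalarTransportOn_shearTransport hv₁ hv₃ hT
  obtain ⟨hWfin, hWL⟩ := memLp_uncurry_of_bound hWm hWb
  have hWunc := Literature.Analysis.FunctionSpaces.Torus.aestronglyMeasurable_uncurry_of_stLift_prod hWm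
  have hv1 : MemLp (fun y : UnitAddTorus (Fin 2) => v₁ (y 1)) 2 volume :=
    hv₁.comp_measurePreserving (measurePreserving_eval (fun _ : Fin 2 => (volume : Measure UnitAddCircle)) 1)
  refine ⟨?_, hS.aestronglyMeasurable_velocity, ?_, hS.lintegral_velocity_lt_top, ?_,
    hS.ae_isWeaklyDivFree, fun ψ hψ => ?_⟩
  · exact Literature.Analysis.FunctionSpaces.Torus.aestronglyMeasurable_stLift_axisAvg_comp_planarSect hWm
  · obtain ⟨C, hC⟩ := hWb
    refine ⟨C, ?_⟩
    filter_upwards [hC,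
      Literature.Analysis.FunctionSpaces.Torus.ae_lintegral_enorm_axisAvg_comp_planarSect_sq_le hWunc]
      with t h1 h2
    exact h2.trans h1
  · -- `u w ∈ L¹`: `‖u‖‖w‖ ≤ ‖u‖² + ‖w‖²`, both with finite space–time integral
    have hab : ∀ a b : ℝ≥0∞, a * b ≤ a ^ 2 + b ^ 2 := by
      intro a b
      rcases le_total a b with h | h
      · calc a * b ≤ b * b := mul_le_mul' h le_rfl
          _ = b ^ 2 := (sq b).symm
          _ ≤ a ^ 2 + b ^ 2 := le_add_self
      · calc a * b ≤ a * a := mul_le_mul' le_rfl h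
          _ = a ^ 2 := (sq a).symm
          _ ≤ a ^ 2 + b ^ 2 := le_self_add
    have hEv : ∫⁻ y : UnitAddTorus (Fin 2), ‖v₁ (y 1)‖ₑ ^ 2 < ⊤ := by
      rw [← Literature.Analysis.FunctionSpaces.eLpNorm_two_pow_two_eq_lintegral]
      exact ENNReal.pow_lt_top hv1.eLpNorm_lt_top
    have hu_sq : ∀ t (y : UnitAddTorus (Fin 2)), ‖shearVelocity v₁ t y‖ₑ ^ 2 = ‖v₁ (y 1)‖ₑ ^ 2 :=
      fun t y => by rw [shearVelocity, enorm_vec2_zero]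
    have hum : AEMeasurable (fun y : UnitAddTorus (Fin 2) => ‖v₁ (y 1)‖ₑ ^ 2) volume :=
      hv1.1.enorm.pow_const 2
    have h1 : ∫⁻ t in Ioo 0 T, ∫⁻ y, ‖shearVelocity v₁ t y‖ₑ *
        ‖(axisAvg (Fin.last 2) (W t) ∘ planarSect) y‖ₑ ≤
        ∫⁻ t in Ioo 0 T, ((∫⁻ y : UnitAddTorus (Fin 2), ‖v₁ (y 1)‖ₑ ^ 2) +
          ∫⁻ y, ‖(axisAvg (Fin.last 2) (W t) ∘ planarSect) y‖ₑ ^ 2) := by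
      refine lintegral_mono fun t => ?_
      calc ∫⁻ y, ‖shearVelocity v₁ t y‖ₑ * ‖(axisAvg (Fin.last 2) (W t) ∘ planarSect) y‖ₑ
          ≤ ∫⁻ y, (‖shearVelocity v₁ t y‖ₑ ^ 2 + ‖(axisAvg (Fin.last 2) (W t) ∘ planarSect) y‖ₑ ^ 2) :=
            lintegral_mono fun y => hab _ _
        _ = (∫⁻ y : UnitAddTorus (Fin 2), ‖v₁ (y 1)‖ₑ ^ 2) +
              ∫⁻ y, ‖(axisAvg (Fin.last 2) (W t) ∘ planarSect) y‖ₑ ^ 2 := by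
            simp_rw [hu_sq]
            exact lintegral_add_left' hum _
    refine h1.trans_lt ?_
    rw [lintegral_add_left' aemeasurable_const]
    refine ENNReal.add_lt_top.2 ⟨?_, ?_⟩
    · rw [lintegral_const, Measure.restrict_apply_univ]
      exact ENNReal.mul_lt_top hEv measure_Ioo_lt_top
    · calc ∫⁻ t in Ioo 0 T, ∫⁻ y, ‖(axisAvg (Fin.last 2) (W t) ∘ planarSect) y‖ₑ ^ 2
          ≤ ∫⁻ t in Ioo 0 T, ∫⁻ x, ‖W t x‖ₑ ^ 2 := lintegral_mono_ae
            (Literature.Analysis.FunctionSpaces.Torus.ae_lintegral_enorm_axisAvg_comp_planarSect_sq_le hWunc)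
        _ < ⊤ := hWfin
  · -- the weak identity, through the adjunction
    set g : ℝ → UnitAddTorus (Fin 2) → ℝ := fun t y =>
      Literature.Analysis.FunctionSpaces.Torus.timeDeriv ψ t y +
        v₁ (y 1) * Literature.Analysis.FunctionSpaces.Torus.partialDeriv 0 (ψ t) y with hg
    -- `g ∈ L²((0,T) × T²)`
    have hb₁ := spaceTime_of_continuous_uncurry (b := Literature.Analysis.FunctionSpaces.Torus.timeDeriv ψ)
      hψ.continuous_uncurry_timeDeriv T
    have hb₂ := spaceTime_of_continuous_uncurry
      (b := fun t => Literature.Analysis.FunctionSpaces.Torus.partialDeriv 0 (ψ t))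
      (hψ.continuous_uncurry_partialDeriv 0) T
    obtain ⟨-, ⟨K, hK⟩, -, hb₂L⟩ := hb₂
    have hV : MemLp (uncurry fun (_ : ℝ) (y : UnitAddTorus (Fin 2)) => v₁ (y 1)) 2
        (((volume : Measure ℝ).restrict (Ioo 0 T)).prod (volume : Measure (UnitAddTorus (Fin 2)))) :=
      hv1.comp_snd _
    have hVb := (memLp_mul_of_bound hV hb₂L.1 hK).1
    have hgL : MemLp (uncurry g) 2
        (((volume : Measure ℝ).restrict (Ioo 0 T)).prod (volume : Measure (UnitAddTorus (Fin 2)))) := by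
      have h := hb₁.2.2.2.add hVb
      exact h
    have hm0 : AEStronglyMeasurable (fun y : UnitAddTorus (Fin 2) => v₃ y * ψ 0 y) volume :=
      hv₃.1.mul (hψ.isSmooth_slice 0).continuous.aestronglyMeasurable
    have hW' : (∫ t in Ioo 0 T, ∫ x : UnitAddTorus (Fin 3), W t x * g t (planarProj x)) +
        ∫ x : UnitAddTorus (Fin 3), v₃ (planarProj x) * ψ 0 (planarProj x) = 0 := hWeq ψ hψ
    rw [Literature.Analysis.FunctionSpaces.Torus.setIntegral_integral_mul_comp_planarProj_eq hWL hgL,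
      Literature.Analysis.FunctionSpaces.Torus.integral_comp_planarProj (b := fun y => v₃ y * ψ 0 y) hm0] at hW'
    have hinner : ∀ t (y : UnitAddTorus (Fin 2)),
        Literature.Analysis.FunctionSpaces.Torus.timeDeriv ψ t y +
          ⟪shearVelocity v₁ t y, Literature.Analysis.FunctionSpaces.Torus.gradient (ψ t) y⟫ +
          0 * Literature.Analysis.FunctionSpaces.Torus.laplacian (ψ t) y = g t y := by
      intro t y
      rw [inner_shearVelocity_gradient v₁ ((hψ.isSmooth_slice t).isContDiff (by simp)), zero_mul, add_zero]
    simp_rw [hinner]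
    exact hW'

end Reduction

/-! ## The named fact from Lemma 4 -/

/-- **`BardosTitiWiedemann2012_thm5_limitEq` from Lemma 4** (Bardos–Titi–Wiedemann 2012, proof
of Thm. 5: "`u` satisfies (6) … Next, it follows from Lemma 4 above that system (6) has a
unique solution, and that this unique solution is given precisely by the shear flow (4)").
Proof: (1) the weak-* limit `W` of the third components solves the weak transport equation on
`T³` against tests of `(t,x₁,x₂)` (`BardosTitiWiedemann2012_thm5_limit_weakTransport`);
(2) `W` does not depend on `x₃`: it is a.e. its third-axis average — weak limits of fields that do
not depend on `x₃` do not depend on `x₃` (`Torus.ae_eq_axisAvg_of_tendsto`) — which is the planar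
lift of its planar section `w` (`Torus.axisAvg_last_eq_comp`); (3) `w` is a weak solution of the
transport equation of Lemma 4 on `T²` (`isWeakScalarTransportOn_axisAvg_limit`), as is the shear
transport `v₃(x₁ - t v₁(x₂), x₂)` (`isWeakScalarTransportOn_shearTransport`); (4) by the
uniqueness conjunct of `BardosTitiWiedemann2012_lemma4` they agree for a.e. `t`, and pulling back
along `planarProj` identifies `W(t)` with the third component of the shear flow. Only the
uniqueness conjunct of the hypothesis is used. [cite: BardosTitiWiedemann2012, Thm. 5, proof] -/
theorem BardosTitiWiedemann2012_thm5_limitEq_of_lemma4 (h4 : BardosTitiWiedemann2012_lemma4) :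
    BardosTitiWiedemann2012_thm5_limitEq := by
  intro v₁ hv₁ v₃ hv₃ T hT ν hν hν₀ a c hU W hWm hWb hheat hweak
  -- (1) the weak transport identity on `T³`
  have hWeq : ∀ ψ : ℝ → UnitAddTorus (Fin 2) → ℝ, Literature.Analysis.FunctionSpaces.Torus.IsSpaceTimeTest T ψ →
      (∫ t in Ioo 0 T, ∫ x : UnitAddTorus (Fin 3), W t x *
        (Literature.Analysis.FunctionSpaces.Torus.timeDeriv ψ t (Fin.init x) +
          v₁ (x 1) * Literature.Analysis.FunctionSpaces.Torus.partialDeriv 0 (ψ t) (Fin.init x))) +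
      ∫ x : UnitAddTorus (Fin 3), v₃ (Fin.init x) * ψ 0 (Fin.init x) = 0 := fun ψ hψ =>
    BardosTitiWiedemann2012_thm5_limit_weakTransport v₁ hv₁ v₃ hv₃ T ν hν hν₀ a c hU W hWm hWb
      hheat hweak hψ
  -- (2) `W` is a.e. its third-axis average
  obtain ⟨hWfin, hWL⟩ := memLp_uncurry_of_bound hWm hWb
  have hmem : MemLp (shearData v₁ v₃) 2 volume := memLp_shearData hv₁ hv₃
  have hB : ∀ᵐ t ∂(volume.restrict (Ioo 0 T)), W t =ᵐ[volume] axisAvg (Fin.last 2) (W t) := by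
    refine Literature.Analysis.FunctionSpaces.Torus.ae_eq_axisAvg_of_tendsto (Fin.last 2)
      (θ := fun j t (x : UnitAddTorus (Fin 3)) => c j t (Fin.init x))
      (fun j t s x => Literature.Analysis.FunctionSpaces.Torus.comp_planarProj_add_single (c j t) s x)
      (fun j => (shearField_components_memLp (hν j).le hmem (hU j)).2.1) hWL fun G hG => ?_
    have h := hweak G (Literature.Analysis.FunctionSpaces.Torus.aestronglyMeasurable_stLift_of_uncurry hG.1)
      (lintegral_lt_top_of_memLp_uncurry hG)
    simp_rw [vec2_eq_init] at h
    exact h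
  -- (3) the planar section of the average and the shear transport both solve Lemma 4's equation
  have hw := isWeakScalarTransportOn_axisAvg_limit hv₁ hv₃ hT hWm hWb hWeq
  have hS := isWeakScalarTransportOn_shearTransport hv₁ hv₃ hT
  -- (4) uniqueness, and pull back along `planarProj`
  have hu := (h4 v₁ hv₁ v₃ hv₃ T hT).2 _ _ hw hS
  filter_upwards [hB, hu] with t h1 h2
  have h3 : ((axisAvg (Fin.last 2) (W t) ∘ planarSect) ∘ planarProj)
      =ᵐ[volume] (shearTransport v₁ v₃ t ∘ planarProj) :=
    Literature.Analysis.FunctionSpaces.Torus.measurePreserving_planarProj.quasiMeasurePreserving.ae_eq h2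
  rw [Literature.Analysis.FunctionSpaces.Torus.axisAvg_last_eq_comp (W t)] at h1
  refine h1.trans (h3.trans (Eventually.of_forall fun x => ?_))
  simp only [comp_apply, vec2_eq_init]
  rfl

end Literature.Barriers.AnomalousDissipation

end
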